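import Summits.QuantumFields.YangMills.Theorems.BalabanUVNodesK1V9Adapters
import Summits.QuantumFields.YangMills.Theorems.BalabanUVNodesK2CornerRoadLine2W
import Summits.QuantumFields.YangMills.Theorems.BalabanUVNodesK1R9BodyAtRevisedRecordWorldOfNodesWRunLetters

/-!
# K1 «v10» LINE 2′ (LINE 2 WINDOW-GUARDED; plan g86, director-ym №216 (ii)) — THE WITNESS ADAPTERS AT A RUNG-1ⱽᵂ WITNESS (GUARDED NODES) AND THE REGISTERED VW STUB TEXTS BY NAME:
# LINE-2′ twins of this seat's `K1V9Adapters` §1∕§2 (p630603) on the RUN-LETTER (`RunRemAt` ∕ `RemAt`), |β|-BOX + (PS), CEILING-KEYED and `Cont13All` currencies, concluding DEF-1's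
# `K1V10Defs.RunRowsContAtSomeRecord13PWSVW F` ∕ the registered `stub_runRows13PWSVW` ∕ `stub_cont13VW` signatures

Cell `pub-ymgap`, WIDTH SEAT `pub-ymgap-dag-n24-w1` (gen 5; director-ym №197 ∕ HUMAN RULING D-0149).  `--kind proof --supports stmt-QuantumFields-27364 --as helper` (dag-lead KEY MAP v2; count-neutral).
[I] = [Balaban1987RG1]; [II] = [Balaban1988RG2Cluster]; [III] = [Balaban1988Convergent]; [IV] = [Balaban1989LargeFieldI]; [V] = [Balaban1989LargeFieldII].

WHY.  Plan g86 registered K1 «v10» = LINE 1 ∪ LINE 2′ on the DECIDING crux K1⁹ `StabilityBRunRowsAtRecordR13SepCoPHV` = stmt-QuantumFields-27364 (skeleton sha16 4b84746c2d4b6041,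
2026-08-28T12:43:28Z; HARD FREEZE №216 (f)).  LINE 2′ = LINE 2 with the thirteen nodes (and the [IV]-pin) asked only on runs INSIDE THE WORLD's COUPLING WINDOW, `(leavesP w P).smallCouplings →
Nodes (leavesP w P)` (dag-n24-c g11 LOCATED-RUNG1-PIN option (α)); the run-rows block is byte-identical V → VW.  ym-nodeO DEF-1 g9's by-name mirror `K1V10Defs` (p634834) carries the three VW
rung texts, the doors V ⟹ VW and the projections, and names «the LINE-2′ adapters» as THIS seat's lane (its docstring; bus l.37636).  Every V-rung CONCLUSION of `K1V9Adapters` reaches LINE 2′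
through `K1V10Defs.…VW_of_V`; but a proof of the REGISTERED `stub_nodes13PWSVW` hands only WINDOW-GUARDED nodes, which the V adapters do not accept as INPUT — so the witness-level junctions and
the ∃-side bridges are re-typed here at a rung-1ⱽᵂ witness.  ym-nodeO PORT-1 g5's `…K2CornerRoadLine2W` (p636268) did this on the CORNER ∕ ROW-MASS currencies (U3ᴷ-lite moduli, anchor,
drift; (α♭) runs) and typed `stub_cont13VWText_of_boxModuli` and the guarded N11CU raise `ceilingKeyedRung1VW_of_nodesW_of_b14RaiseW` — CITED here, nothing of it restated.  THIS FILE covers the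
remaining currencies of record: DEF-1's run letter `RunRemAt` ∕ box letter `RemAt` + the bare drift + match (K2⁷'s 2ᴮ″ pair), K0⁷ 3ᴬ′'s sign-free |β| box + (PS) + (C), the generic
ceiling-keyed guarded family, and the ∀θ (C) letter `Cont13All`.

CONTENTS (0 `def`, 0 `sorry`; [folklore] bookkeeping over displayed hypothesis shapes).
§1 (witness adapters at `(θ, h, v, w)` with `RecordSV` and GUARDED nodes, concluding `RunRowsContAtSomeRecord13PWSVW F`): `runRowsContVWAt_of_runRowsVWAt_of_survCont` (level-free junction:
rows at `γ₀` + `SurvCont` at ANY `γc` ⟹ rung 2ⱽᵂ‴ at `min`) · `…_of_betaContH` · `runRowsContVWAt_of_rung1VWAt_of_absBox_of_runwisePS_of_survCont` · ★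
`runRowsContAtSomeRecord13PWSVW_of_runRemAt_drift_match` (ONE run letter pays stubs 2ⱽᵂ and 3ⱽᵂ) · `…_of_remAt_drift_match`.
§2 (guarded ceiling-keyed family `∀ c, ∃ w, c ≤ w.βup ∧ RecordSV F θ h v w ∧ ∀ P, smallCouplings → Nodes`): `runRowsContVWAt_of_ceilingKeyedRung1VW_of_rows_of_survCont` ·
`…_of_runRemAt_drift` (NO match).
§3 (the REGISTERED v10 LINE-2′ stub signatures BY NAME over DEF-1's texts): ★ `stub_cont13VW_of_cont13All` (= skeleton `stubCont13VW_of_cont13All`; LINE-2′ twin of `K1V9Defs.stub_cont13V_of_cont13All`) ·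
`stub_cont13VW_of_survContLetter` (the weaker θ-keyed letter «SOME level with (C)» suffices: the junction is level-free) · ★ `stub_runRowsCont13VWText_of_n11CUVW_runRemAtDriftText` (joint
2ⱽᵂ∘3ⱽᵂ text from PORT-1's in-window N11CU raise letter + the ∀θ run-letter pair «`RunRemAt` + drift», NO numeric match) · `stub_runRows13PWSVWText_of_n11CUVW_runRemAtDriftText`.
§4 (∃-side producers «rung 0 ⟹ rung 2ⱽᵂ‴», conclusion `∀ F, Inhabited13 F → RunRowsContAtSomeRecord13PWSVW F` = the input of any «VW texts ⟹ K1⁹» composition): ★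
`rung2VW_of_rung1VWWithRunRemAt` · ★ `rung2VW_of_ceilingKeyedRung1VWWithRunRemAt` (NO match) · `rung2VW_of_ceilingKeyedRung1VWWithBoundedRowsCont`.
§5 (v1.1, APPEND-ONLY; §1–§4 byte-identical to v1 p638958): K1⁹ `…Theses.BalabanUVNodes.StabilityBRunRowsAtRecordR13SepCoPHV` BY NAME from each §4 producer and from the §3 texts, through
dag-n24-c g12's W-END road `…K1R9BodyAtRevisedRecordWorldOfNodesWRunLetters.stabilityBRunRowsAtRecordR13SepCoPHV_byName_of_rowsContWitnessVW` ∕ `…_of_stubTextsVW` (p638487; imported, not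
restated): ★ `stabilityBRunRowsAtRecordR13SepCoPHV_of_rung1VWWithRunRemAt` · ★ `…_of_ceilingKeyedRung1VWWithRunRemAt` (NO match) · `…_of_ceilingKeyedRung1VWWithBoundedRowsCont` · ★
`…_of_stub1VW_n11CUVW_runRemAtDriftText` (registered stub-1ⱽᵂ text + the two ∀θ letters) · `…_of_stub1VW_stub2VW_cont13All`.  From the V rungs K1⁹ is `K1V9Adapters` §3 unchanged.

HONEST FRAMING.  By-name glue and small adapters; NOTHING of Bałaban asserted; NO stub proved (every §3 theorem is CONDITIONAL on displayed letters none of which is supplied here); nothing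
registered or re-registered; K0⁷ stmt-QuantumFields-20541 ∕ K1⁹ stmt-QuantumFields-27364 (DECIDING; v10 0∕6) ∕ K3⁸ stmt-QuantumFields-27366 OPEN; N24 COMPOSITE.  Counts unmoved (typed 28∕28 ·
discharged 5∕27 (A 5∕28)).  [I] Thm 2 + (0.31) p. 259 and §1's continuity pp. 263–264 UNPROVED in print.  One finite 𝕋⁴ programme at fixed `ε = L^{−K}`, Bałaban AS PRINTED — NOT continuum ∕
ℝ⁴ ∕ OS ∕ mass gap ∕ Clay: the Yang–Mills mass gap is NOT proved by any of this; route R4 closes the CONDITIONAL finite-𝕋⁴ rung `BalabanLadder.UV` only.  No `sorry`, `def`, `instance`,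
`notation`; standard axioms.
Sources (context only): [V] Thm 1 p. 355 + (0.1) pp. 355–356; [IV] (1.2) p. 178; [III] Thm 1 p. 262, (2.6) p. 255, (2.18) p. 257; [I] Thm 3 p. 264, (1.20)–(1.22) p. 264, (2.12)–(2.14)
p. 268, (5.10) p. 293, §1 pp. 263–264; [II] (2.41) p. 21.
-/

noncomputable section

open scoped Matrix.Norms.L2Operator

namespace Summit.QuantumFields.YangMills.Theorems.K1V10Adapters

open Literature.MathematicalPhysics.QuantumFieldTheory.Balaban1983to89
open Literature.MathematicalPhysics.QuantumFieldTheory.Balaban1983to89.T4Continuum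
open Literature.MathematicalPhysics.QuantumFieldTheory.Balaban1983to89.DagBinding
open FlowStepRuns
open FlowStep (HBeta RGEqH prefixOf BetaContH BetaLowerH BetaUpperH)
open Summit.QuantumFields.YangMills.Theorems.BalabanUVNodesK2NamedJetsRunRemAt (RunRemAt RunConstRemainder SurvCont runwisePS_of_drift_runConstRemainder runRemAt_of_remAt)
open Summit.QuantumFields.YangMills.Theorems.BalabanUVNodesK2NamedJetsRemAt (RemAt band_of_drift)
open Summit.QuantumFields.YangMills.Theorems.BalabanUVNodesK2JsOfRecord (StepColourData beta0OfJs)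
open Literature.MathematicalPhysics.QuantumFieldTheory.Balaban1983to89.Beta.Drift (OneLoopDrift)
open Summit.QuantumFields.YangMills.Theorems.EndpointGivenBR13SepCoPH.Negative.RemNamedJets13FalseOfTwoNormalisations (oneLoopDrift_const_mul)
open Summit.QuantumFields.YangMills.BalabanUVNodes.N17RunRemAtOfShiftAnchorLevel (survCont_anti)
open Summit.QuantumFields.YangMills.BalabanUVNodes.K1RunRowsOfBoxAndPartialSums (runConstRemainder_of_boxBounds)
open Summit.QuantumFields.YangMills.Theorems.K1V6Defs (Inhabited13)
open Summit.QuantumFields.YangMills.Theorems.BalabanUVNodesK1R8RowsDefs (Cont13All)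
open Summit.QuantumFields.YangMills.Theorems.K1V9Defs (RecordSV)
open Summit.QuantumFields.YangMills.Theorems.K1V10Defs (NodesAtSomeRecord13PWSVW RunRowsAtSomeRecord13PWSVW RunRowsContAtSomeRecord13PWSVW
  runRowsAtSomeRecord13PWSVW_of_runRowsContAtSomeRecord13PWSVW)
open Summit.QuantumFields.YangMills.Theorems.BalabanUVNodesK2CornerRoadLine2W (ceilingKeyedRung1VW_of_nodesW_of_b14RaiseW)

/-! ## §1 Witness-level adapters at a rung-1ⱽᵂ witness (GUARDED nodes): the level-matching in stub 3ⱽᵂ is free; ONE run letter pays stubs 2ⱽᵂ and 3ⱽᵂ -/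

section Witness

variable {F : T4Family}

/-- **★ THE LEVEL-FREE JUNCTION AT A RUNG-1ⱽᵂ WITNESS**: at `(θ, h, v, w)` (unity ∧ slots, admissibility, an S-bound world of the REVISED datum `datumOfRecord₁₃SepCoPHV θ h v` with the thirteen
nodes on every run INSIDE the coupling window), the rows (i)–(iv) of `β_θ` at SOME level `γ₀ > 0` AND `SurvCont β_θ γc` at ANY level `γc > 0` give rung 2ⱽᵂ‴ at the level `min γ₀ γc`
(`RunConstRemainder.mono`, floor restricted, dag-n17-w1's `survCont_anti`).  = `K1V9Adapters.runRowsContVAt_of_runRowsVAt_of_survCont` with the guard threaded (the rows are θ-level).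
[cite: Balaban1987RG1, Thm 3 p.264, (1.22) p.264, §1 pp.263–264 (bookkeeping)] -/
theorem runRowsContVWAt_of_runRowsVWAt_of_survCont (θ : Node00.Stage13HParams F 2) (h : θ.Provisos₁₃SepCoPH F 2) (v : Node00.Revision₁₃ F 2 θ h) (w : WorldP)
    (hU : θ.ZhUnity F 2 ∧ θ.SlotsNondegenerate₁₃ F 2) (hθ : θ.Admissible F 2) (hR : RecordSV F θ h v w)
    (hnodesW : ∀ P : B12.RunParams, (leavesP w P).smallCouplings → Nodes (leavesP w P))
    {b : ℕ → ℝ} {r γ₀ B M : ℝ} (hγ₀ : 0 < γ₀) (hrem : RunConstRemainder (Node00.betaOfRecord₁₃ F 2 θ.toStage13Params) b r γ₀) (hB : ∀ k, b k ≤ B) (hmatch : B + r ≤ w.βup)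
    (hps : ∀ (n : ℕ) (gs : ℕ → ℝ), RGEqH n (Node00.betaOfRecord₁₃ F 2 θ.toStage13Params) gs → Step.InInterval γ₀ n gs →
      ∀ k, k ≤ n → -M ≤ ∑ j ∈ Finset.Ico k n, Node00.betaOfRecord₁₃ F 2 θ.toStage13Params j (prefixOf gs j))
    {γc : ℝ} (hγc : 0 < γc) (hsc : SurvCont (Node00.betaOfRecord₁₃ F 2 θ.toStage13Params) γc) : RunRowsContAtSomeRecord13PWSVW F := by
  refine ⟨θ, h, v, w, hU, hθ, hR, hnodesW, b, r, min γ₀ γc, B, M, lt_min hγ₀ hγc, hrem.mono (min_le_left _ _), hB, hmatch, ?_,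
    survCont_anti (lt_min hγ₀ hγc) (min_le_right _ _) hsc⟩
  intro n gs hrg hI k hk
  exact hps n gs hrg (fun j hj => ⟨(hI j hj).1, (hI j hj).2.trans (min_le_left _ _)⟩) k hk

/-- The same junction with the BOX continuity letter `BetaContH γc β_θ` in place of `SurvCont` (DEF-1's `SurvCont.of_betaContH`). [cite: Balaban1987RG1, §1 pp.263–264 (bookkeeping)] -/
theorem runRowsContVWAt_of_runRowsVWAt_of_betaContH (θ : Node00.Stage13HParams F 2) (h : θ.Provisos₁₃SepCoPH F 2) (v : Node00.Revision₁₃ F 2 θ h) (w : WorldP)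
    (hU : θ.ZhUnity F 2 ∧ θ.SlotsNondegenerate₁₃ F 2) (hθ : θ.Admissible F 2) (hR : RecordSV F θ h v w)
    (hnodesW : ∀ P : B12.RunParams, (leavesP w P).smallCouplings → Nodes (leavesP w P))
    {b : ℕ → ℝ} {r γ₀ B M : ℝ} (hγ₀ : 0 < γ₀) (hrem : RunConstRemainder (Node00.betaOfRecord₁₃ F 2 θ.toStage13Params) b r γ₀) (hB : ∀ k, b k ≤ B) (hmatch : B + r ≤ w.βup)
    (hps : ∀ (n : ℕ) (gs : ℕ → ℝ), RGEqH n (Node00.betaOfRecord₁₃ F 2 θ.toStage13Params) gs → Step.InInterval γ₀ n gs →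
      ∀ k, k ≤ n → -M ≤ ∑ j ∈ Finset.Ico k n, Node00.betaOfRecord₁₃ F 2 θ.toStage13Params j (prefixOf gs j))
    {γc : ℝ} (hγc : 0 < γc) (hcont : BetaContH γc (Node00.betaOfRecord₁₃ F 2 θ.toStage13Params)) : RunRowsContAtSomeRecord13PWSVW F :=
  runRowsContVWAt_of_runRowsVWAt_of_survCont θ h v w hU hθ hR hnodesW hγ₀ hrem hB hmatch hps hγc (SurvCont.of_betaContH hγc hcont)

/-- **AT A RUNG-1ⱽᵂ WITNESS CARRYING A SIGN-FREE |β| BOX, LINE 2′'s β-SIDE STUB PAIR IS «(PS) FLOOR + (C)»**: guarded rung-1ⱽᵂ data + `BetaLowerH (−β′) γ₀ β_θ ∧ BetaUpperH β′ γ₀ β_θ` (K0⁷ 3ᴬ′'s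
currency) + `β′ ≤ w.βup` + run-wise (PS) with defect `M` + `SurvCont β_θ γc` at ANY level ⊢ rung 2ⱽᵂ‴ (`b :≡ 0`, `r := β′`, `B := 0`).  = `K1V9Adapters.…VAt_of_rung1VAt_of_absBox_…` guarded.
[cite: Balaban1987RG1, §1 (1.22) p.264, Thm 2 p.259, Thm 3 p.264, §1 pp.263–264; Balaban1988RG2Cluster, (2.41) p.21 (bookkeeping)] -/
theorem runRowsContVWAt_of_rung1VWAt_of_absBox_of_runwisePS_of_survCont (θ : Node00.Stage13HParams F 2) (h : θ.Provisos₁₃SepCoPH F 2) (v : Node00.Revision₁₃ F 2 θ h) (w : WorldP)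
    (hU : θ.ZhUnity F 2 ∧ θ.SlotsNondegenerate₁₃ F 2) (hθ : θ.Admissible F 2) (hR : RecordSV F θ h v w)
    (hnodesW : ∀ P : B12.RunParams, (leavesP w P).smallCouplings → Nodes (leavesP w P))
    {γ₀ β' M : ℝ} (hγ₀ : 0 < γ₀) (hlow : BetaLowerH (-β') γ₀ (Node00.betaOfRecord₁₃ F 2 θ.toStage13Params)) (hup : BetaUpperH β' γ₀ (Node00.betaOfRecord₁₃ F 2 θ.toStage13Params))
    (hmatch : β' ≤ w.βup)
    (hps : ∀ (n : ℕ) (gs : ℕ → ℝ), RGEqH n (Node00.betaOfRecord₁₃ F 2 θ.toStage13Params) gs → Step.InInterval γ₀ n gs →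
      ∀ k, k ≤ n → -M ≤ ∑ j ∈ Finset.Ico k n, Node00.betaOfRecord₁₃ F 2 θ.toStage13Params j (prefixOf gs j))
    {γc : ℝ} (hγc : 0 < γc) (hsc : SurvCont (Node00.betaOfRecord₁₃ F 2 θ.toStage13Params) γc) : RunRowsContAtSomeRecord13PWSVW F := by
  have hrem := runConstRemainder_of_boxBounds hlow hup
  have e1 : (-β' + β') / 2 = (0 : ℝ) := by ring
  have e2 : (β' - -β') / 2 = β' := by ring
  rw [e1, e2] at hrem
  exact runRowsContVWAt_of_runRowsVWAt_of_survCont θ h v w hU hθ hR hnodesW (B := 0) hγ₀ hrem (fun _ => le_rfl) (by linarith) hps hγc hsc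

/-- **★ ONE RUN LETTER PAYS STUBS 2ⱽᵂ AND 3ⱽᵂ**: at guarded rung-1ⱽᵂ data, DEF-1's `RunRemAt F κ θ h c` (run-wise constant remainder of `β_θ` relative to `c • beta0OfJs F κ` with cap,
`SurvCont` at its own level) + the bare drift + the numeric match `2c·stepBal 2 F.L + 2|c|A ≤ w.βup` ⊢ rung 2ⱽᵂ‴ at the letter's level.  The letter is keyed at `(θ, h)` only — slot and
guard ride with the world.  = `K1V9Adapters.runRowsContAtSomeRecord13PWSV_of_runRemAt_drift_match` guarded.
[cite: Balaban1987RG1, Thm 3 p.264, (1.20)–(1.22) p.264, (2.12)–(2.14) p.268, (5.10) p.293, §1 pp.263–264 (bookkeeping)] -/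
theorem runRowsContAtSomeRecord13PWSVW_of_runRemAt_drift_match (θ : Node00.Stage13HParams F 2) (h : θ.Provisos₁₃SepCoPH F 2) (v : Node00.Revision₁₃ F 2 θ h) (w : WorldP)
    (hU : θ.ZhUnity F 2 ∧ θ.SlotsNondegenerate₁₃ F 2) (hθ : θ.Admissible F 2) (hR : RecordSV F θ h v w)
    (hnodesW : ∀ P : B12.RunParams, (leavesP w P).smallCouplings → Nodes (leavesP w P))
    (κ : StepColourData) {c A : ℝ} (hRun : RunRemAt F κ θ h c) (hdrift : OneLoopDrift (B12Normalization.stepBal 2 F.L) A (beta0OfJs F κ))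
    (hmatch : 2 * (c * B12Normalization.stepBal 2 F.L) + 2 * (|c| * A) ≤ w.βup) : RunRowsContAtSomeRecord13PWSVW F := by
  obtain ⟨γ₀, s, hγ₀, -, hcap, hrem, -, hsc⟩ := hRun
  have hd := oneLoopDrift_const_mul hdrift c
  have hband : ∀ k, c * beta0OfJs F κ k ≤ c * B12Normalization.stepBal 2 F.L + 2 * (|c| * A) := fun k => by
    have := (abs_le.mp (band_of_drift hd k)).2
    linarith
  have hmatch' : c * B12Normalization.stepBal 2 F.L + 2 * (|c| * A) + s ≤ w.βup := by linarith
  exact ⟨θ, h, v, w, hU, hθ, hR, hnodesW, fun k => c * beta0OfJs F κ k, s, γ₀, _, _, hγ₀, hrem, hband, hmatch', runwisePS_of_drift_runConstRemainder hd hrem hcap, hsc⟩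

/-- … and with ed.3's BOX letter `RemAt F κ θ h c` (via DEF-1's `runRemAt_of_remAt`). [cite: Balaban1987RG1, (1.20)–(1.22) p.264, (2.12)–(2.14) p.268 (bookkeeping)] -/
theorem runRowsContAtSomeRecord13PWSVW_of_remAt_drift_match (θ : Node00.Stage13HParams F 2) (h : θ.Provisos₁₃SepCoPH F 2) (v : Node00.Revision₁₃ F 2 θ h) (w : WorldP)
    (hU : θ.ZhUnity F 2 ∧ θ.SlotsNondegenerate₁₃ F 2) (hθ : θ.Admissible F 2) (hR : RecordSV F θ h v w)
    (hnodesW : ∀ P : B12.RunParams, (leavesP w P).smallCouplings → Nodes (leavesP w P))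
    (κ : StepColourData) {c A : ℝ} (hRem : RemAt F κ θ h c) (hdrift : OneLoopDrift (B12Normalization.stepBal 2 F.L) A (beta0OfJs F κ))
    (hmatch : 2 * (c * B12Normalization.stepBal 2 F.L) + 2 * (|c| * A) ≤ w.βup) : RunRowsContAtSomeRecord13PWSVW F :=
  runRowsContAtSomeRecord13PWSVW_of_runRemAt_drift_match θ h v w hU hθ hR hnodesW κ (runRemAt_of_remAt F κ θ h hRem) hdrift hmatch

end Witness

/-! ## §2 The GUARDED CEILING-KEYED rung-1ⱽᵂ bridges (LINE-2′ twins of `K1V9Adapters` §2): the match discharged by choosing the world after the rows, at a fixed revision -/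

section Ceiling

variable {F : T4Family}

/-- **THE GUARDED CEILING-KEYED BRIDGE INTO RUNG 2ⱽᵂ‴**: from a ceiling-keyed family of S-bound worlds of ONE revised datum with the thirteen nodes IN-WINDOW — `∀ c, ∃ w, c ≤ w.βup ∧
RecordSV F θ h v w ∧ ∀ P, (leavesP w P).smallCouplings → Nodes (leavesP w P)` (PORT-1's `ceilingKeyedRung1VW_of_nodesW_of_b14RaiseW` produces it from ONE guarded witness + the in-window N11
raise) — and the MATCH-FREE bounded rows + (C) at any level: rung 2ⱽᵂ‴ (world at `c := B + r`).  CONDITIONAL; closes nothing.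
[cite: Balaban1988Convergent, Thm 1 p.262, p.255; Balaban1989LargeFieldI, (1.2) p.178; Balaban1987RG1, Thm 3 p.264, §1 pp.263–264 (bookkeeping)] -/
theorem runRowsContVWAt_of_ceilingKeyedRung1VW_of_rows_of_survCont (θ : Node00.Stage13HParams F 2) (h : θ.Provisos₁₃SepCoPH F 2) (v : Node00.Revision₁₃ F 2 θ h)
    (hU : θ.ZhUnity F 2 ∧ θ.SlotsNondegenerate₁₃ F 2) (hθ : θ.Admissible F 2)
    (hfamW : ∀ c : ℝ, ∃ w : WorldP, c ≤ w.βup ∧ RecordSV F θ h v w ∧ ∀ P : B12.RunParams, (leavesP w P).smallCouplings → Nodes (leavesP w P))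
    {b : ℕ → ℝ} {r γ₀ B M : ℝ} (hγ₀ : 0 < γ₀) (hrem : RunConstRemainder (Node00.betaOfRecord₁₃ F 2 θ.toStage13Params) b r γ₀) (hB : ∀ k, b k ≤ B)
    (hps : ∀ (n : ℕ) (gs : ℕ → ℝ), RGEqH n (Node00.betaOfRecord₁₃ F 2 θ.toStage13Params) gs → Step.InInterval γ₀ n gs →
      ∀ k, k ≤ n → -M ≤ ∑ j ∈ Finset.Ico k n, Node00.betaOfRecord₁₃ F 2 θ.toStage13Params j (prefixOf gs j))
    {γc : ℝ} (hγc : 0 < γc) (hsc : SurvCont (Node00.betaOfRecord₁₃ F 2 θ.toStage13Params) γc) : RunRowsContAtSomeRecord13PWSVW F := by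
  obtain ⟨w, hc, hR, hnodesW⟩ := hfamW (B + r)
  exact runRowsContVWAt_of_runRowsVWAt_of_survCont θ h v w hU hθ hR hnodesW hγ₀ hrem hB hc hps hγc hsc

/-- **THE GUARDED CEILING-KEYED BRIDGE ON THE 2ᴮ″ CURRENCY — NO MATCH**: guarded ceiling-keyed rung-1ⱽᵂ data + ONE `RunRemAt F κ θ h c` + the bare drift ⊢ rung 2ⱽᵂ‴ (world requested at
`c·stepBal 2 F.L + 2|c|A + s`).  CONDITIONAL; closes nothing. [cite: Balaban1987RG1, Thm 3 p.264, (1.20)–(1.22) p.264, (2.12)–(2.14) p.268, §1 pp.263–264 (bookkeeping)] -/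
theorem runRowsContVWAt_of_ceilingKeyedRung1VW_of_runRemAt_drift (θ : Node00.Stage13HParams F 2) (h : θ.Provisos₁₃SepCoPH F 2) (v : Node00.Revision₁₃ F 2 θ h)
    (hU : θ.ZhUnity F 2 ∧ θ.SlotsNondegenerate₁₃ F 2) (hθ : θ.Admissible F 2)
    (hfamW : ∀ c : ℝ, ∃ w : WorldP, c ≤ w.βup ∧ RecordSV F θ h v w ∧ ∀ P : B12.RunParams, (leavesP w P).smallCouplings → Nodes (leavesP w P))
    (κ : StepColourData) {c A : ℝ} (hRun : RunRemAt F κ θ h c) (hdrift : OneLoopDrift (B12Normalization.stepBal 2 F.L) A (beta0OfJs F κ)) :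
    RunRowsContAtSomeRecord13PWSVW F := by
  obtain ⟨γ₀, s, hγ₀, -, hcap, hrem, -, hsc⟩ := hRun
  have hd := oneLoopDrift_const_mul hdrift c
  have hband : ∀ k, c * beta0OfJs F κ k ≤ c * B12Normalization.stepBal 2 F.L + 2 * (|c| * A) := fun k => by
    have := (abs_le.mp (band_of_drift hd k)).2
    linarith
  exact runRowsContVWAt_of_ceilingKeyedRung1VW_of_rows_of_survCont θ h v hU hθ hfamW hγ₀ hrem hband (runwisePS_of_drift_runConstRemainder hd hrem hcap) hγ₀ hsc

end Ceiling

/-! ## §3 The REGISTERED v10 LINE-2′ stub signatures BY NAME (over DEF-1's `K1V10Defs` texts) from ∀θ supplier letters -/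

section Stubs

/-- **★ `Cont13All` ⟹ THE REGISTERED `stub_cont13VW` SIGNATURE `∀ F, RunRowsAtSomeRecord13PWSVW F → RunRowsContAtSomeRecord13PWSVW F`** (= plan's skeleton kernel `stubCont13VW_of_cont13All`,
v10 :521, over the tree names; LINE-2′ twin of DEF-1's `K1V9Defs.stub_cont13V_of_cont13All`): keep the witness `(θ, h, v, w)` and its rows, read (C) at the admissible PRESENTING tuple `θ'` of
`RecordSV` (same unrevised datum of record ⇒ same `β`, by `Node00.βfun_datumOfRecord₁₃SepCoPH`) at the level `min γ₀ w.γ ≤ θ'.γ`.  CONDITIONAL on the letter; the registered stub is NOT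
closed by this theorem; nothing of Bałaban asserted. [cite: Balaban1987RG1, §1 pp.263–264 and Thm 3 p.264 (statement shapes)] -/
theorem stub_cont13VW_of_cont13All (hC : Cont13All) : ∀ F : T4Family, RunRowsAtSomeRecord13PWSVW F → RunRowsContAtSomeRecord13PWSVW F := by
  intro F hrows
  obtain ⟨θ, h, v, w, hU, hθ, hR, hnodesW, b, r, γ₀, B, M, hγ₀, hrem, hB, hmatch, hps⟩ := hrows
  obtain ⟨θ', h', hθ'adm, hD, hC', ⟨hwγ, hwγle⟩, hL, hup⟩ := hR
  have hγ₁ : 0 < min γ₀ w.γ := lt_min hγ₀ hwγ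
  have hγ₁le : min γ₀ w.γ ≤ θ'.γ := (min_le_right _ _).trans hwγle
  have hβ : Node00.betaOfRecord₁₃ F 2 θ'.toStage13Params = Node00.betaOfRecord₁₃ F 2 θ.toStage13Params := by
    have := congrArg (fun D => D.βfun) hD
    simpa [Node00.βfun_datumOfRecord₁₃SepCoPH] using this.symm
  have hsc : SurvCont (Node00.betaOfRecord₁₃ F 2 θ.toStage13Params) (min γ₀ w.γ) := by
    have := hC F θ' h' hθ'adm (min γ₀ w.γ) hγ₁ hγ₁le
    rwa [hβ] at this
  exact runRowsContVWAt_of_runRowsVWAt_of_survCont θ h v w hU hθ ⟨θ', h', hθ'adm, hD, hC', ⟨hwγ, hwγle⟩, hL, hup⟩ hnodesW hγ₀ hrem hB hmatch hps hγ₁ hsc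

/-- **THE REGISTERED `stub_cont13VW` SIGNATURE FROM THE WEAKER θ-KEYED LETTER «(C) ON SOME LEVEL»** at every unity ∕ admissible tuple with provisos (no matching of levels with `θ.γ` or with the
rows' `γ₀` asked: the junction is level-free).  CONDITIONAL on the letter; the registered stub is NOT closed by this theorem. [cite: Balaban1987RG1, §1 pp.263–264 (statement shape)] -/
theorem stub_cont13VW_of_survContLetter
    (hCθ : ∀ (F : T4Family) (θ : Node00.Stage13HParams F 2), θ.Provisos₁₃SepCoPH F 2 → (θ.ZhUnity F 2 ∧ θ.SlotsNondegenerate₁₃ F 2) → θ.Admissible F 2 →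
      ∃ γc : ℝ, 0 < γc ∧ SurvCont (Node00.betaOfRecord₁₃ F 2 θ.toStage13Params) γc) :
    ∀ F : T4Family, RunRowsAtSomeRecord13PWSVW F → RunRowsContAtSomeRecord13PWSVW F := by
  intro F hrows
  obtain ⟨θ, h, v, w, hU, hθ, hR, hnodesW, b, r, γ₀, B, M, hγ₀, hrem, hB, hmatch, hps⟩ := hrows
  obtain ⟨γc, hγc, hsc⟩ := hCθ F θ h hU hθ
  exact runRowsContVWAt_of_runRowsVWAt_of_survCont θ h v w hU hθ hR hnodesW hγ₀ hrem hB hmatch hps hγc hsc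

/-- **★ THE REGISTERED JOINT TEXT 2ⱽᵂ∘3ⱽᵂ «∀ F, NodesAtSomeRecord13PWSVW F → RunRowsContAtSomeRecord13PWSVW F» ON THE RUN-LETTER CURRENCY, NO NUMERIC MATCH**: from `hN11VW` = PORT-1's
in-window ceiling-uniform N11 raise at guarded rung-1ⱽᵂ core data (for every ceiling `c`, SOME `γ' ∈ ]0, w.γ]` with `Dag.B14_main` IN-WINDOW at `{w with βup := c, γ := γ'}`) and `hRun` = the
∀θ run-letter pair «SOME scale `κ`, `RunRemAt F κ θ h c` + the bare drift of `beta0OfJs F κ`» (K2⁷'s 2ᴮ″ currency; DEF-1's RUN EDITION p596574) keyed on provisos ∕ unity ∧ slots ∕ admissibility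
ALONE.  The stub-1ⱽᵂ pins (`PrintedUV3V`, the [IV]-pin) are read and dropped.  CONDITIONAL on the two displayed letters (none supplied here); closes NO stub by itself.
[cite: Balaban1988Convergent, Thm 1 p.262, (2.6) p.255; Balaban1989LargeFieldI, (1.2) p.178; Balaban1987RG1, Thm 3 p.264, (1.20)–(1.22) p.264, (2.12)–(2.14) p.268, §1 pp.263–264 (statement shapes)] -/
theorem stub_runRowsCont13VWText_of_n11CUVW_runRemAtDriftText
    (hN11VW : ∀ (F : T4Family) (θ : Node00.Stage13HParams F 2) (h : θ.Provisos₁₃SepCoPH F 2) (v : Node00.Revision₁₃ F 2 θ h) (w : WorldP),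
      (θ.ZhUnity F 2 ∧ θ.SlotsNondegenerate₁₃ F 2) → θ.Admissible F 2 → RecordSV F θ h v w → (∀ P : B12.RunParams, (leavesP w P).smallCouplings → Nodes (leavesP w P)) →
      ∀ c : ℝ, ∃ γ' : ℝ, 0 < γ' ∧ γ' ≤ w.γ ∧ ∀ P : B12.RunParams,
        (leavesP { w with βup := c, γ := γ' } P).smallCouplings → Dag.B14_main (leavesP { w with βup := c, γ := γ' } P))
    (hRun : ∀ (F : T4Family) (θ : Node00.Stage13HParams F 2) (h : θ.Provisos₁₃SepCoPH F 2), (θ.ZhUnity F 2 ∧ θ.SlotsNondegenerate₁₃ F 2) → θ.Admissible F 2 →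
      ∃ (κ : StepColourData) (c A : ℝ), RunRemAt F κ θ h c ∧ OneLoopDrift (B12Normalization.stepBal 2 F.L) A (beta0OfJs F κ)) :
    ∀ F : T4Family, NodesAtSomeRecord13PWSVW F → RunRowsContAtSomeRecord13PWSVW F := by
  intro F hN
  obtain ⟨θ, h, v, w, hU, hθ, hR, hnodesW, -, -⟩ := hN
  obtain ⟨κ, c, A, hR', hdrift⟩ := hRun F θ h hU hθ
  exact runRowsContVWAt_of_ceilingKeyedRung1VW_of_runRemAt_drift θ h v hU hθ
    (ceilingKeyedRung1VW_of_nodesW_of_b14RaiseW θ h v w hR hnodesW (hN11VW F θ h v w hU hθ hR hnodesW)) κ hR' hdrift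

/-- **THE REGISTERED `stub_runRows13PWSVW` SIGNATURE ON THE RUN-LETTER CURRENCY** ((C) dropped from the joint text).  CONDITIONAL on the two letters; the registered stub is NOT closed by this
theorem. [cite: Balaban1987RG1, Thm 3 p.264, (5.10) p.293 (statement shapes)] -/
theorem stub_runRows13PWSVWText_of_n11CUVW_runRemAtDriftText
    (hN11VW : ∀ (F : T4Family) (θ : Node00.Stage13HParams F 2) (h : θ.Provisos₁₃SepCoPH F 2) (v : Node00.Revision₁₃ F 2 θ h) (w : WorldP),
      (θ.ZhUnity F 2 ∧ θ.SlotsNondegenerate₁₃ F 2) → θ.Admissible F 2 → RecordSV F θ h v w → (∀ P : B12.RunParams, (leavesP w P).smallCouplings → Nodes (leavesP w P)) →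
      ∀ c : ℝ, ∃ γ' : ℝ, 0 < γ' ∧ γ' ≤ w.γ ∧ ∀ P : B12.RunParams,
        (leavesP { w with βup := c, γ := γ' } P).smallCouplings → Dag.B14_main (leavesP { w with βup := c, γ := γ' } P))
    (hRun : ∀ (F : T4Family) (θ : Node00.Stage13HParams F 2) (h : θ.Provisos₁₃SepCoPH F 2), (θ.ZhUnity F 2 ∧ θ.SlotsNondegenerate₁₃ F 2) → θ.Admissible F 2 →
      ∃ (κ : StepColourData) (c A : ℝ), RunRemAt F κ θ h c ∧ OneLoopDrift (B12Normalization.stepBal 2 F.L) A (beta0OfJs F κ)) :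
    ∀ F : T4Family, NodesAtSomeRecord13PWSVW F → RunRowsAtSomeRecord13PWSVW F :=
  fun F hN => runRowsAtSomeRecord13PWSVW_of_runRowsContAtSomeRecord13PWSVW F (stub_runRowsCont13VWText_of_n11CUVW_runRemAtDriftText hN11VW hRun F hN)

end Stubs

/-! ## §4 ∃-side producers «rung 0 ⟹ rung 2ⱽᵂ‴» (the input of every «three VW texts ⟹ K1⁹» composition — the W-END road, dag-n24-c's lane — is ONE line away from each) -/

section Producers

/-- **★ RUNG 2ⱽᵂ‴ FROM ONE ∃-SIDE PRODUCER «GUARDED RUNG 1ⱽᵂ WITH THE RUN LETTER AT THE WITNESS»**: for every family with a unity Stage-13 tuple, SOME `(θ, h)`, SOME revision `v`, at SOME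
scale the run letter `RunRemAt F κ θ h c` with the bare drift, and an S-bound world of the REVISED datum whose ceiling clears `2c·stepBal 2 F.L + 2|c|A` with the thirteen nodes IN-WINDOW
⊢ `∀ F, Inhabited13 F → RunRowsContAtSomeRecord13PWSVW F` (the hypothesis of the W-END composition to K1⁹).  CONDITIONAL on `h`; nothing of Bałaban asserted; closes nothing.
[cite: Balaban1989LargeFieldII, Thm 1 p.355 + (0.1) pp.355–356; Balaban1989LargeFieldI, (1.2) p.178; Balaban1987RG1, Thm 3 p.264, (1.20)–(1.22) p.264, (2.12)–(2.14) p.268, §1 pp.263–264; Balaban1988Convergent, (2.6) p.255, Thm 1 p.262 (bookkeeping)] -/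
theorem rung2VW_of_rung1VWWithRunRemAt
    (h : ∀ F : T4Family, Inhabited13 F →
      ∃ (θ : Node00.Stage13HParams F 2) (h : θ.Provisos₁₃SepCoPH F 2) (v : Node00.Revision₁₃ F 2 θ h), (θ.ZhUnity F 2 ∧ θ.SlotsNondegenerate₁₃ F 2) ∧ θ.Admissible F 2 ∧
        ∃ (κ : StepColourData) (c A : ℝ), RunRemAt F κ θ h c ∧ OneLoopDrift (B12Normalization.stepBal 2 F.L) A (beta0OfJs F κ) ∧
          ∃ w : WorldP, 2 * (c * B12Normalization.stepBal 2 F.L) + 2 * (|c| * A) ≤ w.βup ∧ RecordSV F θ h v w ∧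
            ∀ P : B12.RunParams, (leavesP w P).smallCouplings → Nodes (leavesP w P)) :
    ∀ F : T4Family, Inhabited13 F → RunRowsContAtSomeRecord13PWSVW F := fun F hinh => by
  obtain ⟨θ, hP, v, hU, hθ, κ, c, A, hRun, hdrift, w, hmatch, hR, hnodesW⟩ := h F hinh
  exact runRowsContAtSomeRecord13PWSVW_of_runRemAt_drift_match θ hP v w hU hθ hR hnodesW κ hRun hdrift hmatch

/-- **★ RUNG 2ⱽᵂ‴, MATCH-FREE, FROM «GUARDED CEILING-KEYED RUNG 1ⱽᵂ + THE RUN LETTER»** — the β-side input is exactly K2⁷'s 2ᴮ″ pair «`RunRemAt` + drift» at the K1 tuple; NO numeric match.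
CONDITIONAL on `h`; closes nothing. [cite: Balaban1989LargeFieldII, Thm 1 p.355; Balaban1988Convergent, Thm 1 p.262, (2.18) p.257; Balaban1989LargeFieldI, (1.2) p.178; Balaban1987RG1, Thm 3 p.264, (1.20)–(1.22) p.264, §1 pp.263–264 (bookkeeping)] -/
theorem rung2VW_of_ceilingKeyedRung1VWWithRunRemAt
    (h : ∀ F : T4Family, Inhabited13 F →
      ∃ (θ : Node00.Stage13HParams F 2) (h : θ.Provisos₁₃SepCoPH F 2) (v : Node00.Revision₁₃ F 2 θ h), (θ.ZhUnity F 2 ∧ θ.SlotsNondegenerate₁₃ F 2) ∧ θ.Admissible F 2 ∧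
        (∀ c : ℝ, ∃ w : WorldP, c ≤ w.βup ∧ RecordSV F θ h v w ∧ ∀ P : B12.RunParams, (leavesP w P).smallCouplings → Nodes (leavesP w P)) ∧
        ∃ (κ : StepColourData) (c A : ℝ), RunRemAt F κ θ h c ∧ OneLoopDrift (B12Normalization.stepBal 2 F.L) A (beta0OfJs F κ)) :
    ∀ F : T4Family, Inhabited13 F → RunRowsContAtSomeRecord13PWSVW F := fun F hinh => by
  obtain ⟨θ, hP, v, hU, hθ, hfamW, κ, c, A, hRun, hdrift⟩ := h F hinh
  exact runRowsContVWAt_of_ceilingKeyedRung1VW_of_runRemAt_drift θ hP v hU hθ hfamW κ hRun hdrift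

/-- **RUNG 2ⱽᵂ‴, MATCH-FREE, ON THE GENERIC ROWS CURRENCY**: guarded ceiling-keyed rung 1ⱽᵂ + the match-free bounded rows (i)(ii)(iv) + (C) on one level, at SOME revision.  CONDITIONAL; closes nothing.
[cite: Balaban1989LargeFieldII, Thm 1 p.355; Balaban1988Convergent, Thm 1 p.262; Balaban1989LargeFieldI, (1.2) p.178; Balaban1987RG1, Thm 3 p.264, (5.10) p.293, §1 pp.263–264 (bookkeeping)] -/
theorem rung2VW_of_ceilingKeyedRung1VWWithBoundedRowsCont
    (h : ∀ F : T4Family, Inhabited13 F →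
      ∃ (θ : Node00.Stage13HParams F 2) (h : θ.Provisos₁₃SepCoPH F 2) (v : Node00.Revision₁₃ F 2 θ h), (θ.ZhUnity F 2 ∧ θ.SlotsNondegenerate₁₃ F 2) ∧ θ.Admissible F 2 ∧
        (∀ c : ℝ, ∃ w : WorldP, c ≤ w.βup ∧ RecordSV F θ h v w ∧ ∀ P : B12.RunParams, (leavesP w P).smallCouplings → Nodes (leavesP w P)) ∧
        ∃ (b : ℕ → ℝ) (r γ₀ B M : ℝ), 0 < γ₀ ∧ RunConstRemainder (Node00.betaOfRecord₁₃ F 2 θ.toStage13Params) b r γ₀ ∧ (∀ k, b k ≤ B) ∧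
          (∀ (n : ℕ) (gs : ℕ → ℝ), RGEqH n (Node00.betaOfRecord₁₃ F 2 θ.toStage13Params) gs → Step.InInterval γ₀ n gs →
            ∀ k, k ≤ n → -M ≤ ∑ j ∈ Finset.Ico k n, Node00.betaOfRecord₁₃ F 2 θ.toStage13Params j (prefixOf gs j)) ∧
          SurvCont (Node00.betaOfRecord₁₃ F 2 θ.toStage13Params) γ₀) :
    ∀ F : T4Family, Inhabited13 F → RunRowsContAtSomeRecord13PWSVW F := fun F hinh => by
  obtain ⟨θ, hP, v, hU, hθ, hfamW, b, r, γ₀, B, M, hγ₀, hrem, hB, hps, hsc⟩ := h F hinh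
  exact runRowsContVWAt_of_ceilingKeyedRung1VW_of_rows_of_survCont θ hP v hU hθ hfamW hγ₀ hrem hB hps hγ₀ hsc

end Producers

/-! ## §5 (v1.1, APPEND-ONLY) K1⁹ `StabilityBRunRowsAtRecordR13SepCoPHV` BY NAME from each §4 producer and from the §3 joint texts, through dag-n24-c g12's W-END road
`K1R9BodyAtRevisedRecordWorldOfNodesWRunLetters.stabilityBRunRowsAtRecordR13SepCoPHV_byName_of_rowsContWitnessVW` (p638487) — the LINE-2′ twins of `K1V9Adapters` §3 -/

section K1R9

/-- **★ K1⁹ BY NAME FROM ONE ∃-SIDE PRODUCER «GUARDED RUNG 1ⱽᵂ WITH THE RUN LETTER AT THE WITNESS»** (= §4 `rung2VW_of_rung1VWWithRunRemAt` ∘ dag-n24-c's W-END composition): for every family with a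
unity Stage-13 tuple, SOME `(θ, h)`, SOME revision `v`, at SOME scale `RunRemAt F κ θ h c` with the bare drift, and an S-bound world of the REVISED datum whose ceiling clears
`2c·stepBal 2 F.L + 2|c|A` with the thirteen nodes asked only INSIDE ITS COUPLING WINDOW.  Conclusion = `…Theses.BalabanUVNodes.StabilityBRunRowsAtRecordR13SepCoPHV` literally.  CONDITIONAL on
`h`; K1⁹ NOT closed by this theorem; nothing of Bałaban asserted. [cite: Balaban1989LargeFieldII, Thm 1 p.355 + (0.1) pp.355–356; Balaban1989LargeFieldI, (1.2) p.178; Balaban1987RG1, Thm 2 p.259, Thm 3 p.264, (1.20)–(1.22) p.264, (2.12)–(2.14) p.268, §1 pp.263–264; Balaban1988Convergent, (2.6) p.255, Cor. 3 (2.50) p.264, (2.18) p.257 (bookkeeping)] -/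
theorem stabilityBRunRowsAtRecordR13SepCoPHV_of_rung1VWWithRunRemAt
    (h : ∀ F : T4Family, Inhabited13 F →
      ∃ (θ : Node00.Stage13HParams F 2) (h : θ.Provisos₁₃SepCoPH F 2) (v : Node00.Revision₁₃ F 2 θ h), (θ.ZhUnity F 2 ∧ θ.SlotsNondegenerate₁₃ F 2) ∧ θ.Admissible F 2 ∧
        ∃ (κ : StepColourData) (c A : ℝ), RunRemAt F κ θ h c ∧ OneLoopDrift (B12Normalization.stepBal 2 F.L) A (beta0OfJs F κ) ∧
          ∃ w : WorldP, 2 * (c * B12Normalization.stepBal 2 F.L) + 2 * (|c| * A) ≤ w.βup ∧ RecordSV F θ h v w ∧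
            ∀ P : B12.RunParams, (leavesP w P).smallCouplings → Nodes (leavesP w P)) :
    Summit.QuantumFields.YangMills.Theses.BalabanUVNodes.StabilityBRunRowsAtRecordR13SepCoPHV :=
  Summit.QuantumFields.YangMills.BalabanUVNodes.K1R9BodyAtRevisedRecordWorldOfNodesWRunLetters.stabilityBRunRowsAtRecordR13SepCoPHV_byName_of_rowsContWitnessVW
    (rung2VW_of_rung1VWWithRunRemAt h)

/-- **★ K1⁹ BY NAME, MATCH-FREE, FROM «GUARDED CEILING-KEYED RUNG 1ⱽᵂ + THE RUN LETTER»** — β-side input = exactly K2⁷'s 2ᴮ″ pair «`RunRemAt` + drift» at the K1 tuple; nodes only in-window; NO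
numeric match.  CONDITIONAL on `h`; K1⁹ NOT closed by this theorem. [cite: Balaban1989LargeFieldII, Thm 1 p.355; Balaban1988Convergent, Thm 1 p.262, (2.18) p.257; Balaban1989LargeFieldI, (1.2) p.178; Balaban1987RG1, Thm 3 p.264, (1.20)–(1.22) p.264, §1 pp.263–264 (bookkeeping)] -/
theorem stabilityBRunRowsAtRecordR13SepCoPHV_of_ceilingKeyedRung1VWWithRunRemAt
    (h : ∀ F : T4Family, Inhabited13 F →
      ∃ (θ : Node00.Stage13HParams F 2) (h : θ.Provisos₁₃SepCoPH F 2) (v : Node00.Revision₁₃ F 2 θ h), (θ.ZhUnity F 2 ∧ θ.SlotsNondegenerate₁₃ F 2) ∧ θ.Admissible F 2 ∧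
        (∀ c : ℝ, ∃ w : WorldP, c ≤ w.βup ∧ RecordSV F θ h v w ∧ ∀ P : B12.RunParams, (leavesP w P).smallCouplings → Nodes (leavesP w P)) ∧
        ∃ (κ : StepColourData) (c A : ℝ), RunRemAt F κ θ h c ∧ OneLoopDrift (B12Normalization.stepBal 2 F.L) A (beta0OfJs F κ)) :
    Summit.QuantumFields.YangMills.Theses.BalabanUVNodes.StabilityBRunRowsAtRecordR13SepCoPHV :=
  Summit.QuantumFields.YangMills.BalabanUVNodes.K1R9BodyAtRevisedRecordWorldOfNodesWRunLetters.stabilityBRunRowsAtRecordR13SepCoPHV_byName_of_rowsContWitnessVW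
    (rung2VW_of_ceilingKeyedRung1VWWithRunRemAt h)

/-- **K1⁹ BY NAME, MATCH-FREE, ON THE GENERIC ROWS CURRENCY** (guarded ceiling-keyed rung 1ⱽᵂ + match-free bounded rows (i)(ii)(iv) + (C) on one level, at SOME revision).  CONDITIONAL; K1⁹
NOT closed. [cite: Balaban1989LargeFieldII, Thm 1 p.355; Balaban1988Convergent, Thm 1 p.262; Balaban1989LargeFieldI, (1.2) p.178; Balaban1987RG1, Thm 3 p.264, (5.10) p.293, §1 pp.263–264 (bookkeeping)] -/
theorem stabilityBRunRowsAtRecordR13SepCoPHV_of_ceilingKeyedRung1VWWithBoundedRowsCont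
    (h : ∀ F : T4Family, Inhabited13 F →
      ∃ (θ : Node00.Stage13HParams F 2) (h : θ.Provisos₁₃SepCoPH F 2) (v : Node00.Revision₁₃ F 2 θ h), (θ.ZhUnity F 2 ∧ θ.SlotsNondegenerate₁₃ F 2) ∧ θ.Admissible F 2 ∧
        (∀ c : ℝ, ∃ w : WorldP, c ≤ w.βup ∧ RecordSV F θ h v w ∧ ∀ P : B12.RunParams, (leavesP w P).smallCouplings → Nodes (leavesP w P)) ∧
        ∃ (b : ℕ → ℝ) (r γ₀ B M : ℝ), 0 < γ₀ ∧ RunConstRemainder (Node00.betaOfRecord₁₃ F 2 θ.toStage13Params) b r γ₀ ∧ (∀ k, b k ≤ B) ∧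
          (∀ (n : ℕ) (gs : ℕ → ℝ), RGEqH n (Node00.betaOfRecord₁₃ F 2 θ.toStage13Params) gs → Step.InInterval γ₀ n gs →
            ∀ k, k ≤ n → -M ≤ ∑ j ∈ Finset.Ico k n, Node00.betaOfRecord₁₃ F 2 θ.toStage13Params j (prefixOf gs j)) ∧
          SurvCont (Node00.betaOfRecord₁₃ F 2 θ.toStage13Params) γ₀) :
    Summit.QuantumFields.YangMills.Theses.BalabanUVNodes.StabilityBRunRowsAtRecordR13SepCoPHV :=
  Summit.QuantumFields.YangMills.BalabanUVNodes.K1R9BodyAtRevisedRecordWorldOfNodesWRunLetters.stabilityBRunRowsAtRecordR13SepCoPHV_byName_of_rowsContWitnessVW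
    (rung2VW_of_ceilingKeyedRung1VWWithBoundedRowsCont h)

/-- **★ K1⁹ BY NAME FROM THE REGISTERED STUB-1ⱽᵂ TEXT + THE TWO ∀θ LETTERS OF THE §3 JOINT TEXT** (`h₁` = `stub_nodes13PWSVW`'s signature `∀ F, Inhabited13 F → NodesAtSomeRecord13PWSVW F`;
`hN11VW` = PORT-1's in-window ceiling-uniform N11 raise; `hRun` = the ∀θ run-letter pair «`RunRemAt` + drift»): the joint 2ⱽᵂ∘3ⱽᵂ text composed with `h₁` and the W-END road.  CONDITIONAL on
three displayed texts (none supplied here); K1⁹ NOT closed; nothing of Bałaban asserted.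
[cite: Balaban1989LargeFieldII, Thm 1 p.355 + (0.1) pp.355–356; Balaban1988Convergent, Thm 1 p.262, (2.6) p.255; Balaban1989LargeFieldI, (1.2) p.178; Balaban1987RG1, Thm 3 p.264, (1.20)–(1.22) p.264, (2.12)–(2.14) p.268, §1 pp.263–264 (statement shapes)] -/
theorem stabilityBRunRowsAtRecordR13SepCoPHV_of_stub1VW_n11CUVW_runRemAtDriftText
    (h₁ : ∀ F : T4Family, Inhabited13 F → NodesAtSomeRecord13PWSVW F)
    (hN11VW : ∀ (F : T4Family) (θ : Node00.Stage13HParams F 2) (h : θ.Provisos₁₃SepCoPH F 2) (v : Node00.Revision₁₃ F 2 θ h) (w : WorldP),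
      (θ.ZhUnity F 2 ∧ θ.SlotsNondegenerate₁₃ F 2) → θ.Admissible F 2 → RecordSV F θ h v w → (∀ P : B12.RunParams, (leavesP w P).smallCouplings → Nodes (leavesP w P)) →
      ∀ c : ℝ, ∃ γ' : ℝ, 0 < γ' ∧ γ' ≤ w.γ ∧ ∀ P : B12.RunParams,
        (leavesP { w with βup := c, γ := γ' } P).smallCouplings → Dag.B14_main (leavesP { w with βup := c, γ := γ' } P))
    (hRun : ∀ (F : T4Family) (θ : Node00.Stage13HParams F 2) (h : θ.Provisos₁₃SepCoPH F 2), (θ.ZhUnity F 2 ∧ θ.SlotsNondegenerate₁₃ F 2) → θ.Admissible F 2 →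
      ∃ (κ : StepColourData) (c A : ℝ), RunRemAt F κ θ h c ∧ OneLoopDrift (B12Normalization.stepBal 2 F.L) A (beta0OfJs F κ)) :
    Summit.QuantumFields.YangMills.Theses.BalabanUVNodes.StabilityBRunRowsAtRecordR13SepCoPHV :=
  Summit.QuantumFields.YangMills.BalabanUVNodes.K1R9BodyAtRevisedRecordWorldOfNodesWRunLetters.stabilityBRunRowsAtRecordR13SepCoPHV_byName_of_rowsContWitnessVW
    fun F hinh => stub_runRowsCont13VWText_of_n11CUVW_runRemAtDriftText hN11VW hRun F (h₁ F hinh)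

/-- **K1⁹ BY NAME FROM THE REGISTERED STUB-1ⱽᵂ AND STUB-2ⱽᵂ TEXTS + THE ∀θ (C) LETTER `Cont13All`** (stub 3ⱽᵂ's text supplied by §3 `stub_cont13VW_of_cont13All`; = dag-n24-c's `…_of_stubTextsVW`
with its third argument discharged by the letter).  CONDITIONAL on the two texts and the letter; K1⁹ NOT closed. [cite: Balaban1989LargeFieldII, Thm 1 p.355; Balaban1987RG1, §1 pp.263–264, Thm 3 p.264 (statement shapes)] -/
theorem stabilityBRunRowsAtRecordR13SepCoPHV_of_stub1VW_stub2VW_cont13All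
    (h₁ : ∀ F : T4Family, Inhabited13 F → NodesAtSomeRecord13PWSVW F)
    (h₂ : ∀ F : T4Family, NodesAtSomeRecord13PWSVW F → RunRowsAtSomeRecord13PWSVW F) (hC : Cont13All) :
    Summit.QuantumFields.YangMills.Theses.BalabanUVNodes.StabilityBRunRowsAtRecordR13SepCoPHV :=
  Summit.QuantumFields.YangMills.BalabanUVNodes.K1R9BodyAtRevisedRecordWorldOfNodesWRunLetters.stabilityBRunRowsAtRecordR13SepCoPHV_of_stubTextsVW h₁ h₂
    (stub_cont13VW_of_cont13All hC)

end K1R9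

end Summit.QuantumFields.YangMills.Theorems.K1V10Adapters

end
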